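import Summits.BirchSwinnertonDyer.Rank1Residual.GaloisImage.ComparisonOperatorLevelChange
import Summits.BirchSwinnertonDyer.Rank1Residual.GaloisImage.PropagatedStructureCartesian
import Summits.BirchSwinnertonDyer.Rank1Residual.GaloisImage.KolyvaginCoreVertices
import Summits.BirchSwinnertonDyer.Rank1Residual.GaloisImage.KolyvaginDeepSubclassTransport
import Summits.BirchSwinnertonDyer.Rank1Residual.GaloisImage.KolyvaginPrimeLocalShapeRatHolds
import Summits.BirchSwinnertonDyer.Rank1Residual.GaloisImage.SakamotoN11Instance
import Summits.BirchSwinnertonDyer.Rank1Residual.GaloisImage.SakamotoN11InstanceResidual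
import Literature.NumberTheory.EllipticCurves.KummerSequenceConnecting
import Mathlib.LinearAlgebra.Dimension.OrzechProperty
import HarnessLib

/-!
# The pair `E[3] ↪ E[9] ↠ E[3]`: short exact sequence, `H¹`, local shapes and bases — the
# inputs of the injectivity dévissage `m = 1 ⟹ m = 2`
# (cell `b2b-bsdres`, team n1011, seat p15 GEN 4, OWNERS row T-INJ-DEV, file F-B2a;
# skeleton `cells/n1011/skel/T-INJ-DEV.md`)

HONEST FRAMING (cell `b2b-bsdres`, run/shared/lean/b2b/bsd-rank1-residual/, verbatim in every
file): the goal of the cell is to DELETE the COMBINATION-SHAPED residual classes of the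
Birch–Swinnerton-Dyer formula for ALL analytic-rank `≤ 1` elliptic curves over `ℚ` — "full BSD
formula for every rank `≤ 1` curve in class `C`" assembled STRICTLY from published theorems — so
that the rank-`≤ 1` remainder becomes exactly the CONSTRUCTION-SHAPED classes, which are TYPED
(missing-input `Prop`s), NOT attempted. This is not "finishing BSD". Team n1011 (N10 / N11, the
additive block X4 ∧ `p = 3`): research route on the CONSTRUCTION-SHAPED class X4; TOOL theorems; no
class theorem; nothing is booked; no label and no RESIDUAL-MAP mark is moved. Theorems only: no
definition, no named fact, no `sorry`.

## What and why

The instance `0 → E[3] →(incl) E[9] →([3]) E[3] → 0` of the generic dévissage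
`KSDevissage.apply_eq_zero_of_apply_eq_zero_of_devissage_self` (file F-A), with Mazur–Rubin's
canonical structure `𝓕_can` on `E[9]` (`propagatedSelmerStructure W 3 1`) and `𝓕̄_can` on `E[3]`
(`propagatedSelmerStructureOne W 3`), for ANY Kolyvagin datum `D₉` on `E[9]` whose primes lie in
Sakamoto's class at level `9` (so also the DEEP classes through `E[27]`, …) with cyclotomic
transverse conditions and THE canonical comparison maps, and the datum `D′` on `E[3]` with the
same primes, cyclotomic transverse conditions and the canonical comparison maps for the same
primitive roots:

* §1 the short exact sequence and its `H¹` consequences over `ℚ` (exactness at `H¹(ℚ, E[9])`;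
  `incl_*` injective when `E(ℚ)[3] = 0`);
* §2 the hypotheses of F-A for this pair: Selmer push/pull = n1011-p13's
  `induced_propagatedSelmerStructure` / `isCartesianAt_propagatedSelmerStructure` (NO hypothesis on
  `E(ℚ₃)[3]` — at `v = 3` the local `incl_*` may have a kernel on `t = 1` rows, harmless in the
  cartesian PULL form); transverse push (naturality of restriction); transverse pull at the primes
  from the local shapes (`H¹ = H¹_ur ⊔ H¹_tr` on `E[3]`, `H¹_ur ⊓ H¹_tr = 0` on `E[9]`) and the
  LOCAL injectivity of `incl_*` (`#H⁰(ℚ_q, E[9]) = 9`, `#H⁰(ℚ_q, E[3]) = 3` ⟹ `[3]` maps the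
  invariants of `E[9]` ONTO those of `E[3]` ⟹ `δ₀ = 0`); comparison transport/reflect = F-B1b for
  canonical data with one `η` (bases: a `ℤ/9`-basis of `E[9]` reduces to a `𝔽₃`-basis of `E[3]`);
* §3 bases: a `ℤ/9`-basis of `E[9]` reduces under `[3]` to an `𝔽₃`-basis of `E[3]` (the basis
  hypothesis of F-B1's `comparisonQ_eq_map`), and the kernel containment `E[3] ↪ E[9]`.
The ASSEMBLY `KSDevissage.apply_eq_zero_of_apply_eq_zero_levelTwo` is the sibling file
`TorsionLevelTwoDevissage.lean` (F-B2b).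

References: B. Mazur, K. Rubin, Mem. AMS 799 (2004) §4.5; R. Sakamoto, JTNB 36 (2024) Def. 3.5,
Thm. 4.4 [Sakamoto2024]; K. Rubin, PCMI 18 (2011) Prop. 1.4.13, Prop. 1.9.5, Def. 1.9.6 [Rubin2011];
J. S. Milne, *ADT* I §6 (the sequence `0 → A_m → A_{m²} → A_m → 0`) [MilneADT2006].
-/

noncomputable section

open scoped Classical NumberField ContRepresentation
open Field NumberField IsDedekindDomain Module
open WeierstrassCurve Literature.NumberTheory.EllipticCurves Literature.NumberTheory.GaloisRepresentations
  Literature.NumberTheory.GaloisRepresentations.DiscreteGaloisModule Literature.NumberTheory.GaloisCohomology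

namespace Summit.BirchSwinnertonDyer.Rank1Residual.GaloisImage.KSDevissage

variable (W : WeierstrassCurve ℚ) [W.IsElliptic]

/-! ### §1 The short exact sequence `0 → E[3] → E[9] → E[3] → 0` and `H¹` -/

omit [W.IsElliptic] in
/-- **`0 → E[3] →(incl) E[9] →([3]) E[3] → 0` is a short exact sequence of discrete `Γ_ℚ`-modules**
(`E[9] = E[3¹·3]`, `[3] = torsionMulBy 3¹ 3`; surjectivity = divisibility of `E(ℚ̄)`), Milne's
`0 → A_m → A_{m²} →ᵐ A_m → 0`. [cite: MilneADT2006, Ch. I §6, proof of Prop. 6.9] -/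
theorem isSES_three_nine :
    IsSES (DiscreteGaloisModule.homOfIntertwining
        (W.torsionInclusion (Dvd.intro_left _ rfl : ((3 : ℕ) : ℤ) ∣ ((3 : ℕ) : ℤ) ^ 1 * ((3 : ℕ) : ℤ))))
      (DiscreteGaloisModule.homOfIntertwining (W.torsionMulBy (((3 : ℕ) : ℤ) ^ 1) ((3 : ℕ) : ℤ))) where
  comp_eq_zero := by
    ext P
    have h := (mem_geomTorsion_iff W ((3 : ℕ) : ℤ) _).mp P.2
    change (((3 : ℕ) : ℤ) ^ 1) • ((P : geomTorsion W ((3 : ℕ) : ℤ)) : geomPoints W) = 0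
    rw [pow_one]
    exact h
  injective := fun P Q h => Subtype.ext (congrArg Subtype.val h :)
  exact_mid := fun P hP => by
    have hP' : (((3 : ℕ) : ℤ) ^ 1) • (P : geomPoints W) = 0 := congrArg Subtype.val hP
    have hP'' : ((3 : ℕ) : ℤ) • (P : geomPoints W) = 0 := by simpa only [pow_one] using hP'
    exact ⟨⟨P, (mem_geomTorsion_iff W _ _).mpr hP''⟩, rfl⟩
  surjective := fun Q => by
    have hk : (((3 : ℕ) : ℤ) ^ 1) ≠ 0 := by norm_num
    obtain ⟨P, hP⟩ := W.zsmul_geomPoints_surjective_of_charZero hk (Q : geomPoints W)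
    have hP' : (((3 : ℕ) : ℤ) ^ 1) • P = (Q : geomPoints W) := hP
    have hPmem : P ∈ geomTorsion W (((3 : ℕ) : ℤ) ^ 1 * ((3 : ℕ) : ℤ)) := by
      rw [mem_geomTorsion_iff, mul_comm, mul_zsmul, hP']
      exact (mem_geomTorsion_iff W _ _).mp Q.2
    exact ⟨⟨P, hPmem⟩, Subtype.ext hP'⟩

omit [W.IsElliptic] in
/-- **Exactness at `H¹(ℚ, E[9])`**: a class killed by `[3]_*` comes from `H¹(ℚ, E[3])` (the
hypothesis `hexact` of the dévissage). [cite: SerreGaloisCohomology1997, I §2.2] -/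
theorem exists_map_torsionInclusion_eq_of_map_torsionMulBy_eq_zero
    (x : galoisCohomology (W.torsionGaloisModule (((3 : ℕ) : ℤ) ^ 1 * ((3 : ℕ) : ℤ))) 1)
    (hx : galoisCohomology.map (W.torsionMulBy (((3 : ℕ) : ℤ) ^ 1) ((3 : ℕ) : ℤ)) 1 x = 0) :
    ∃ y, galoisCohomology.map
      (W.torsionInclusion (Dvd.intro_left _ rfl : ((3 : ℕ) : ℤ) ∣ ((3 : ℕ) : ℤ) ^ 1 * ((3 : ℕ) : ℤ)))
      1 y = x :=
  (isSES_three_nine W).exists_map_one_eq_of_map_one_eq_zero x hx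

omit [W.IsElliptic] in
/-- **`incl_* : H¹(ℚ, E[3]) → H¹(ℚ, E[9])` is injective when `E(ℚ)[3] = 0`** (its kernel is
`δ₀(H⁰(ℚ, E[3]))`; the hypothesis `hinji` of the dévissage). [cite: SerreGaloisCohomology1997, I §2.2] -/
theorem map_torsionInclusion_injective
    (h0 : ∀ P : geomTorsion W ((3 : ℕ) : ℤ),
      (∀ σ : absoluteGaloisGroup ℚ, W.torsionGaloisModule ((3 : ℕ) : ℤ) σ P = P) → P = 0) :
    Function.Injective (galoisCohomology.map
      (W.torsionInclusion (Dvd.intro_left _ rfl : ((3 : ℕ) : ℤ) ∣ ((3 : ℕ) : ℤ) ^ 1 * ((3 : ℕ) : ℤ)))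
      1) := by
  refine (injective_iff_map_eq_zero _).mpr fun x hx => ?_
  obtain ⟨v, hv⟩ := (isSES_three_nine W).exists_δ₀_eq_of_map_one_eq_zero x hx
  have hv0 : v = 0 := by
    apply Subtype.ext
    exact h0 v.1 fun σ => v.2 σ
  rw [← hv, hv0]
  exact map_zero _

/-! ### §2 The local hypotheses of the dévissage for `(E[3], E[9])` -/

section LocalField

universe u

variable {F : Type u} [Field F] [ValuativeRel F] [TopologicalSpace F] [IsNonarchimedeanLocalField F]
variable {M : Type u} [AddCommGroup M] [TopologicalSpace M] [DiscreteTopology M]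
  {N : Type u} [AddCommGroup N] [TopologicalSpace N] [DiscreteTopology N]
  {ρ : DiscreteGaloisModule F M} {ρ' : DiscreteGaloisModule F N}

omit [TopologicalSpace F] [IsNonarchimedeanLocalField F] in
/-- Equivariant maps preserve unramified classes (naturality of restriction to `F^{ur}`).
[folklore] -/
theorem map_mem_unramifiedSubgroup (g : ρ.toContRepresentation →ⁱL ρ'.toContRepresentation)
    {y : galoisCohomology ρ 1} (hy : y ∈ unramifiedSubgroup ρ 1) :
    galoisCohomology.map g 1 y ∈ unramifiedSubgroup ρ' 1 := by
  rw [DiscreteGaloisModule.mem_unramifiedSubgroup_iff] at hy ⊢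
  rw [galoisCohomology.res_map_one, hy, map_zero]

omit [ValuativeRel F] [TopologicalSpace F] [IsNonarchimedeanLocalField F] in
/-- Equivariant maps preserve `L`-transverse classes (naturality of restriction to `L`).
[cite: Rubin2011, Def. 1.9.4 (p. 14)] -/
theorem map_mem_transverseSubgroup (g : ρ.toContRepresentation →ⁱL ρ'.toContRepresentation)
    (L : Type u) [Field L] [Algebra F L] {y : galoisCohomology ρ 1}
    (hy : y ∈ transverseSubgroup ρ L) : galoisCohomology.map g 1 y ∈ transverseSubgroup ρ' L := by
  rw [mem_transverseSubgroup_iff] at hy ⊢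
  rw [galoisCohomology.res_map_one, hy, map_zero]

end LocalField

section Local

variable {K : Type} [Field K] [NumberField K]
variable {M : Type} [AddCommGroup M] [TopologicalSpace M] [DiscreteTopology M]
  {N : Type} [AddCommGroup N] [TopologicalSpace N] [DiscreteTopology N]
  {ρM : DiscreteGaloisModule K M} {ρN : DiscreteGaloisModule K N}

/-- Equivariant maps preserve unramified local classes at a finite place. [folklore] -/
theorem localMap_mem_unramifiedSubgroup
    (f : ρM.toContRepresentation →ⁱL ρN.toContRepresentation)
    (q : HeightOneSpectrum (𝓞 K)) {y : galoisCohomology (GaloisRep.toLocal q ρM) 1}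
    (hy : y ∈ unramifiedSubgroup (GaloisRep.toLocal q ρM) 1) :
    localMap f (Sum.inr q) y ∈ unramifiedSubgroup (GaloisRep.toLocal q ρN) 1 :=
  map_mem_unramifiedSubgroup (ρ := GaloisRep.toLocal q ρM) (ρ' := GaloisRep.toLocal q ρN)
    (f.restrictField (q.adicCompletion K)) hy

/-- Equivariant maps preserve the cyclotomic transverse conditions at a finite place.
[cite: Rubin2011, Def. 1.9.4 (p. 14)] -/
theorem localMap_mem_cyclotomicTransverse
    (f : ρM.toContRepresentation →ⁱL ρN.toContRepresentation)
    (q : HeightOneSpectrum (𝓞 K)) {y : galoisCohomology (GaloisRep.toLocal q ρM) 1}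
    (hy : y ∈ cyclotomicTransverse ρM (Sum.inr q)) :
    localMap f (Sum.inr q) y ∈ cyclotomicTransverse ρN (Sum.inr q) :=
  map_mem_transverseSubgroup (ρ := GaloisRep.toLocal q ρM) (ρ' := GaloisRep.toLocal q ρN)
    (f.restrictField (q.adicCompletion K)) _ hy

/-- **Transverse pull-back at a Kolyvagin prime from the local shapes**: if `H¹(K_𝔮, N) = H¹_ur ⊔ 𝒯`
on the source, `H¹_ur ⊓ 𝒯 = 0` on the target and `incl_*` is injective on `H¹(K_𝔮, N)`, then a class
whose image is transverse is transverse. [cite: Rubin2011, Prop. 1.9.5 (1) (p. 14)]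
[cite: Sakamoto2024, §4 (p. 925), the splitting `H¹ = H¹_ur ⊕ H¹_tr`] -/
theorem mem_cyclotomicTransverse_of_localMap_mem
    (incl : ρN.toContRepresentation →ⁱL ρM.toContRepresentation) (q : HeightOneSpectrum (𝓞 K))
    (hsup : unramifiedSubgroup (GaloisRep.toLocal q ρN) 1 ⊔ cyclotomicTransverse ρN (Sum.inr q) = ⊤)
    (hinf : unramifiedSubgroup (GaloisRep.toLocal q ρM) 1 ⊓ cyclotomicTransverse ρM (Sum.inr q) = ⊥)
    (hinj : Function.Injective (localMap incl (Sum.inr q)))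
    {x : galoisCohomology (GaloisRep.toLocal q ρN) 1}
    (hx : localMap incl (Sum.inr q) x ∈ cyclotomicTransverse ρM (Sum.inr q)) :
    x ∈ cyclotomicTransverse ρN (Sum.inr q) := by
  have hx' : x ∈ unramifiedSubgroup (GaloisRep.toLocal q ρN) 1 ⊔ cyclotomicTransverse ρN (Sum.inr q) := by
    rw [hsup]; exact AddSubgroup.mem_top x
  obtain ⟨u, hu, t, ht, rfl⟩ := AddSubgroup.mem_sup.mp hx'
  have hiu : localMap incl (Sum.inr q) u ∈
      unramifiedSubgroup (GaloisRep.toLocal q ρM) 1 ⊓ cyclotomicTransverse ρM (Sum.inr q) := by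
    refine AddSubgroup.mem_inf.mpr ⟨localMap_mem_unramifiedSubgroup incl q hu, ?_⟩
    have h := sub_mem hx (localMap_mem_cyclotomicTransverse incl q ht)
    have h2 : localMap incl (Sum.inr q) (u + t) =
        localMap incl (Sum.inr q) u + localMap incl (Sum.inr q) t := map_add _ u t
    rwa [h2, add_sub_cancel_right] at h
  rw [hinf] at hiu
  have hiu0 : localMap incl (Sum.inr q) u = 0 := (AddSubgroup.mem_bot).mp hiu
  have hu0 : u = 0 := hinj (hiu0.trans (map_zero _).symm)
  rw [hu0, zero_add]
  exact ht

end Local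

omit [W.IsElliptic] in
/-- **Local injectivity of `incl_* : H¹(ℚ_q, E[3]) → H¹(ℚ_q, E[9])` at a Kolyvagin prime of level
`9`**: its kernel is `δ₀(H⁰(ℚ_q, E[3]))`, and `[3] : H⁰(ℚ_q, E[9]) → H⁰(ℚ_q, E[3])` is ONTO because
`#H⁰(ℚ_q, E[9]) = 9`, `#H⁰(ℚ_q, E[3]) = 3` and its kernel `H⁰(ℚ_q, E[9]) ∩ E[3]` injects into
`H⁰(ℚ_q, E[3])`. [cite: Rubin2011, Prop. 1.4.13 (1) (p. 9)] [cite: SerreGaloisCohomology1997, I §2.2] -/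
theorem localMap_torsionInclusion_injective (q : HeightOneSpectrum (𝓞 ℚ))
    (h9 : Nat.card (GaloisRep.toLocal q
      (W.torsionGaloisModule (((3 : ℕ) : ℤ) ^ 1 * ((3 : ℕ) : ℤ)))).toTopRep.ρ.invariants = 9)
    (h3 : Nat.card (GaloisRep.toLocal q (W.torsionGaloisModule ((3 : ℕ) : ℤ))).toTopRep.ρ.invariants = 3) :
    Function.Injective (localMap
      (W.torsionInclusion (Dvd.intro_left _ rfl : ((3 : ℕ) : ℤ) ∣ ((3 : ℕ) : ℤ) ^ 1 * ((3 : ℕ) : ℤ)))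
      (Sum.inr q)) := by
  set L := q.adicCompletion ℚ
  have hSES := (isSES_three_nine W).restrictField L
  set ρ₉ := GaloisRep.toLocal q (W.torsionGaloisModule (((3 : ℕ) : ℤ) ^ 1 * ((3 : ℕ) : ℤ))) with hρ₉
  set ρ₃ := GaloisRep.toLocal q (W.torsionGaloisModule ((3 : ℕ) : ℤ)) with hρ₃
  set incl := W.torsionInclusion (Dvd.intro_left _ rfl : ((3 : ℕ) : ℤ) ∣ ((3 : ℕ) : ℤ) ^ 1 * ((3 : ℕ) : ℤ))
    with hincl
  set red := W.torsionMulBy (((3 : ℕ) : ℤ) ^ 1) ((3 : ℕ) : ℤ) with hred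
  haveI : Finite ρ₉.toTopRep.ρ.invariants := Nat.finite_of_card_ne_zero (by rw [h9]; norm_num)
  haveI : Finite ρ₃.toTopRep.ρ.invariants := Nat.finite_of_card_ne_zero (by rw [h3]; norm_num)
  -- `[3]` on invariants
  have hmem : ∀ w : ρ₉.toTopRep.ρ.invariants, red w.1 ∈ ρ₃.toTopRep.ρ.invariants := fun w σ => by
    have h := red.isIntertwining (absGaloisRestrict ℚ L σ) w.1
    change (W.torsionGaloisModule ((3 : ℕ) : ℤ)).toContRepresentation (absGaloisRestrict ℚ L σ)
      (red w.1) = red w.1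
    rw [← h]
    exact congrArg red (w.2 σ)
  let r : ρ₉.toTopRep.ρ.invariants →+ ρ₃.toTopRep.ρ.invariants :=
    { toFun := fun w => ⟨red w.1, hmem w⟩
      map_zero' := Subtype.ext (map_zero red)
      map_add' := fun a b => Subtype.ext (map_add red a.1 b.1) }
  -- the kernel of `r` injects into the invariants of `E[3]`
  have hker : Nat.card r.ker ≤ 3 := by
    refine le_of_le_of_eq ?_ h3
    have hlift : ∀ w : r.ker, ∃ u : ρ₃.toTopRep.ρ.invariants, incl u.1 = w.1.1 := by
      intro w
      have hw0 : red w.1.1 = 0 := congrArg Subtype.val ((AddMonoidHom.mem_ker).mp w.2)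
      obtain ⟨u, hu⟩ := (isSES_three_nine W).exact_mid w.1.1 hw0
      refine ⟨⟨u, fun σ => ?_⟩, hu⟩
      apply (isSES_three_nine W).injective
      change incl ((W.torsionGaloisModule ((3 : ℕ) : ℤ)).toContRepresentation
        (absGaloisRestrict ℚ L σ) u) = incl u
      rw [incl.isIntertwining]
      have hw := w.1.2 σ
      change (W.torsionGaloisModule (((3 : ℕ) : ℤ) ^ 1 * ((3 : ℕ) : ℤ))).toContRepresentation
        (absGaloisRestrict ℚ L σ) w.1.1 = w.1.1 at hw
      rw [← hu] at hw
      exact hw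
    choose lift hlift using hlift
    refine Nat.card_le_card_of_injective lift fun a b hab => ?_
    apply Subtype.ext; apply Subtype.ext
    rw [← hlift a, ← hlift b, hab]
  -- counting: `9 = #range · #ker`, `#range ≤ 3`, `#ker ≤ 3`
  have hcard : Nat.card ρ₉.toTopRep.ρ.invariants = Nat.card r.range * Nat.card r.ker := by
    rw [AddSubgroup.card_eq_card_quotient_mul_card_addSubgroup r.ker,
      Nat.card_congr (QuotientAddGroup.quotientKerEquivRange r).toEquiv]
  have hrange : Nat.card r.range = Nat.card ρ₃.toTopRep.ρ.invariants := by
    refine le_antisymm (AddSubgroup.card_le_card_addGroup r.range) ?_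
    have h1 : Nat.card ρ₉.toTopRep.ρ.invariants = Nat.card r.range * Nat.card r.ker := hcard
    rw [h9] at h1
    rw [h3]
    by_contra hlt
    have h2 : Nat.card r.range * Nat.card r.ker ≤ 2 * 3 := Nat.mul_le_mul (by omega) hker
    omega
  have hsurj : Function.Surjective r := by
    rw [← AddMonoidHom.range_eq_top, ← AddSubgroup.card_eq_iff_eq_top]
    exact hrange
  -- `δ₀ = 0`, so `incl_*` is injective
  refine (injective_iff_map_eq_zero _).mpr fun x hx => ?_
  obtain ⟨v, hv⟩ := hSES.exists_δ₀_eq_of_map_one_eq_zero x hx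
  obtain ⟨w, hw⟩ := hsurj v
  have hδ : hSES.δ₀ v = 0 :=
    (hSES.δ₀_eq_zero_iff v).mpr ⟨w.1, w.2, by rw [← hw]; rfl⟩
  exact hv.symm.trans hδ


/-! ### §3 Bases and the kernel containment -/

/-- **A `ℤ/9`-basis of `E[9]` reduces under `[3]` to an `𝔽₃`-basis of `E[3]`** (both of rank `2`;
`[3] : E[9] ↠ E[3]`), the basis hypothesis of `comparisonQ_eq_map`. [cite: SilvermanAEC2009, Cor. III.6.4(b)] -/
theorem exists_bases_torsionMulBy_three :
    ∃ (n : ℕ) (b : Basis (Fin n) (ZMod (3 ^ (1 + 1))) (geomTorsion W (((3 : ℕ) : ℤ) ^ 1 * ((3 : ℕ) : ℤ))))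
      (b' : Basis (Fin n) (ZMod 3) (geomTorsion W ((3 : ℕ) : ℤ))),
      ∀ i, W.torsionMulBy (((3 : ℕ) : ℤ) ^ 1) ((3 : ℕ) : ℤ) (b i) = b' i := by
  classical
  haveI : Fact (1 < 3 ^ (1 + 1)) := ⟨by norm_num⟩
  haveI : NeZero (3 ^ (1 + 1)) := ⟨by norm_num⟩
  haveI : Finite (geomTorsion W ((3 : ℕ) : ℤ)) := finite_geomTorsion_of_neZero W 3
  haveI : Module.Finite (ZMod 3) (geomTorsion W ((3 : ℕ) : ℤ)) := Module.Finite.of_finite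
  set red := W.torsionMulBy (((3 : ℕ) : ℤ) ^ 1) ((3 : ℕ) : ℤ) with hred
  -- a `ℤ/9`-basis of `E[9]`, indexed by `Fin n`
  let b₀ := Module.Free.chooseBasis (ZMod (3 ^ (1 + 1))) (geomTorsion W (((3 : ℕ) : ℤ) ^ 1 * ((3 : ℕ) : ℤ)))
  let b := b₀.reindex (Fintype.equivFin _)
  -- ranks: both are `2`
  have h9 : Module.finrank (ZMod (3 ^ (1 + 1))) (geomTorsion W (((3 : ℕ) : ℤ) ^ 1 * ((3 : ℕ) : ℤ))) = 2 := by
    obtain ⟨e⟩ := nonempty_linearEquiv_prod_geomTorsion W 3 1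
    rw [← e.finrank_eq, Module.finrank_prod, Module.finrank_self]
  have h3 : Module.finrank (ZMod 3) (geomTorsion W ((3 : ℕ) : ℤ)) = 2 := by
    have h3Q : ((3 : ℕ) : AlgebraicClosure ℚ) ≠ 0 := by norm_num
    have hcard : Nat.card (geomTorsion W ((3 : ℕ) : ℤ)) = 3 ^ 2 :=
      card_torsionPoints_eq_sq_holds W (AlgebraicClosure ℚ) h3Q
    have h := Module.natCard_eq_pow_finrank (K := ZMod 3) (V := geomTorsion W ((3 : ℕ) : ℤ))
    rw [hcard, Nat.card_zmod] at h
    exact (Nat.pow_right_injective (by norm_num : 2 ≤ 3) h).symm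
  have hcard : Fintype.card (Fin (Fintype.card (Module.Free.ChooseBasisIndex (ZMod (3 ^ (1 + 1)))
      (geomTorsion W (((3 : ℕ) : ℤ) ^ 1 * ((3 : ℕ) : ℤ)))))) =
      Module.finrank (ZMod 3) (geomTorsion W ((3 : ℕ) : ℤ)) := by
    rw [Fintype.card_fin, ← Module.finrank_eq_card_chooseBasisIndex, h9, h3]
  -- the reduced family spans `E[3]`
  have hspan : ⊤ ≤ Submodule.span (ZMod 3) (Set.range fun i => red (b i)) := by
    rintro x -
    obtain ⟨y, hy⟩ := (isSES_three_nine W).surjective x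
    have hy' : red y = x := hy
    rw [← hy', ← b.sum_repr y, map_sum]
    refine Submodule.sum_mem _ fun i _ => ?_
    rw [map_zmod_smul_eq_castHom_smul (dvd_pow_self 3 two_ne_zero) red]
    exact Submodule.smul_mem _ _ (Submodule.subset_span ⟨i, rfl⟩)
  exact ⟨_, b, basisOfTopLeSpanOfCardEqFinrank (fun i => red (b i)) hspan hcard, fun i => by
    rw [coe_basisOfTopLeSpanOfCardEqFinrank]⟩

omit [W.IsElliptic] in
/-- `Γ_ℚ` acts trivially on `E[3]` wherever it acts trivially on `E[9]` (`E[3] ↪ E[9]`): the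
kernel containment behind the inclusion of Frobenius classes `𝒫₉ ⊆ 𝒫₃`. [folklore] -/
theorem torsionGaloisModule_three_eq_one_of_nine (u : absoluteGaloisGroup ℚ)
    (hu : W.torsionGaloisModule (((3 : ℕ) : ℤ) ^ 1 * ((3 : ℕ) : ℤ)) u = 1) :
    W.torsionGaloisModule ((3 : ℕ) : ℤ) u = 1 := by
  apply LinearMap.ext
  intro P
  apply (isSES_three_nine W).injective
  change W.torsionInclusion (Dvd.intro_left _ rfl : ((3 : ℕ) : ℤ) ∣ ((3 : ℕ) : ℤ) ^ 1 * ((3 : ℕ) : ℤ))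
      ((W.torsionGaloisModule ((3 : ℕ) : ℤ)).toContRepresentation u P) =
    W.torsionInclusion (Dvd.intro_left _ rfl) P
  rw [ContIntertwiningMap.isIntertwining]
  change W.torsionGaloisModule (((3 : ℕ) : ℤ) ^ 1 * ((3 : ℕ) : ℤ)) u (W.torsionInclusion _ P) = _
  rw [hu]
  rfl

end Summit.BirchSwinnertonDyer.Rank1Residual.GaloisImage.KSDevissage

end
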